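import Mathlib
import HarnessLib
import Literature.NumberTheory.LFunctions.CriticalLineTwoThirds

/-!
# RH-FREE — «nothing here bears on the truth of RH»: Alpöge–Furman 2026 (arXiv:2608.13637),
# Lemma 2.1 (Poisson–Gabor identity) PROVED — the Gabor system at the critical density has a
# translation-invariant frame kernel with no aliasing

Topic `Literature/NumberTheory/LFunctions` (namespace `Literature.NumberTheory.LFunctions`; the two
printed objects `f̂` and `α_k` and the helper lemmas in the sub-namespace `AlpogeFurman2026`).
Next to the statement file `CriticalLineTwoThirds.lean` (cell `rh-columns/lit`, RH literature-typing
tranche 1, unit `rh-lit-frontier-1` gen 3). Two small definitions with bodies (the source's Fourier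
convention `f̂(ξ) = ∫ f(u) e^{−iuξ} du` of §1.7, extended to complex `ξ`, and the sample grid
`α_k = T + 2πk/L` of §2.2) and THEOREMS; no named fact, net debt 0. With
`CriticalLineTwoThirdsSpectralInputs.lean` (Lemma 2.2, (2.9), Lemma 3.3), `…Inertia.lean`
(Lemma 3.1) and `…Proofs.lean` (Lemma 3.2, Lemma 5.6) every LEMMA of [AF26] §§2–3 and §5.3 is then
a kernel theorem of this tree; the Propositions of §§4–5, Theorem 5.7 and Theorems A/B (the analytic
content) are not touched (D-0040) and remain claims of `CriticalLineTwoThirds.lean`.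

## What the source prints (TeX v2 of record, `rh-crit/ah/src/AlpogeFurman2026_arXiv2608.13637v2.tex`)

L. Alpöge, R. Furman, *More than two thirds of the zeros of the Riemann zeta function are simple
and on the critical line*, arXiv:2608.13637v2 (2026), UNREFEREED (D-0012) [key `AlpogeFurman2026`].
§1.7 (TeX l. 162): "`f̂(ξ) = ∫_ℝ f(u) e^{−iuξ} du`." §2.2 (l. 198–220): an even window
`ψ ∈ C²([−½,½])`, `ψ > 0`; `φ(u) := χ(L/2+u) χ(L/2−u) ψ(u/L)^{1/2}` (2.6), so that "`φ ∈ C_c²(ℝ)` is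
even, `0 ≤ φ ≤ 1`, `supp φ = [−L/2, L/2]`"; "Place `α_k := T + 2πk/L` for `k ∈ ℤ` and
`d := ⌊LT/(2π)⌋`"; `v_ρ := (φ̂(γ_ρ − α_k))_{0≤k<d}` (2.8); `a := ‖φ‖₂²/L` (§2.3).

> **Lemma 2.1** (Poisson–Gabor identity; §2.3, p. 4, TeX l. 238–248). For all `z, z′ ∈ ℂ`,
> `Σ_{k∈ℤ} φ̂(z − α_k) φ̂(z′ − α_k) = L · (φ²)^(z − z′)`, in particular
> `Σ_{k∈ℤ} φ̂(z − α_k)² = L‖φ‖₂² = aL²`.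
> For `z = z′` real, truncating to `0 ≤ k < d` gives `‖v_ρ‖₂² ≤ aL²` for `ρ ∈ on`.

Printed proof: Poisson summation for `Υ(s) = φ̂(z−s)φ̂(z′−s)`, whose Fourier transform
`2π (φ_z ∗ φ_{z′})` is supported in `[−L, L]`, so at step `h = 2π/L` only the zero frequency survives.
"Thus the Gabor system at the critical density `h = 2π/L` has a translation-invariant frame kernel
with no aliasing error, for any window supported in an interval of length `L`." (l. 248).

## What is proved here, and how (OURS: a different, shorter route to the printed identity)

The functions `e_k(u) = L^{−1/2} e^{iα_k u}` (`k ∈ ℤ`) form a Hilbert basis of `L²[−L/2, L/2]`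
(Mathlib's `fourierBasis` on `AddCircle L`, shifted by the unimodular factor `e^{iTu}`), and
`φ̂(z − α_k)` is `L` times a Fourier coefficient of `φ e^{−izu} e^{iTu}`; Parseval in the
polarised form `Σ_k ⟪F, e_k⟫⟪e_k, G⟫ = ⟪F, G⟫` (`HilbertBasis.hasSum_inner_mul_inner`) with
`F = conj(φ e^{−izu} e^{iTu})`, `G(u) = φ(−u) e^{iz′u} e^{−iTu}` gives the identity for EVERY
continuous `φ` supported in the open interval `(−L/2, L/2)` (the source's `φ ∈ C_c²` with
`supp φ = [−L/2, L/2]` is such a function: `φ(±L/2) = 0` by continuity), with unconditional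
convergence over `k ∈ ℤ` (`HasSum`):

* `AlpogeFurman2026.hat`, `AlpogeFurman2026.grid` — the printed `f̂` (§1.7) and `α_k` (§2.2);
* `AlpogeFurman2026.hasSum_hat_mul_hat` — `Σ_k φ̂(z−α_k) φ̂(z′−α_k) = L · (φ·φ(−·))^(z − z′)` for
  any continuous `φ : ℝ → ℂ` supported in `(−L/2, L/2)` (no evenness);
* **`AlpogeFurman2026_poisson_gabor`** — Lemma 2.1 AS PRINTED (even `φ`: `φ·φ(−·) = φ²`);
* `AlpogeFurman2026_poisson_gabor_diag` — "in particular `Σ_k φ̂(z − α_k)² = L ∫ φ²`";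
* `AlpogeFurman2026.hat_ofReal_im_eq_zero` (`φ̂` of a real even window is real on `ℝ`) and
  **`AlpogeFurman2026_gabor_truncation`** — "for `z = z′` real, truncating … gives
  `Σ_{k ∈ S} φ̂(γ − α_k)² ≤ L‖φ‖₂²`" for every finite `S ⊂ ℤ` and real `γ` (the bound
  `‖v_ρ‖₂² ≤ aL²` for on-line zeros used in Propositions 4.1–4.2).

LABEL: RH-FREE literature (Fourier series on a circle; a kernel proof verifies, asserts nothing on
authority). Nothing here touches zeros of `ζ`, Weil's explicit formula or the truth of RH.

## References

* [AF26] L. Alpöge, R. Furman, arXiv:2608.13637v2 (2026), §1.7, §2.2 (2.6)–(2.8), Lemma 2.1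
  (§2.3, p. 4). [key `AlpogeFurman2026`]
-/

noncomputable section

open Complex MeasureTheory Set Filter AddCircle
open scoped Real ComplexConjugate InnerProductSpace

namespace Literature.NumberTheory.LFunctions

namespace AlpogeFurman2026

/-! ## The printed objects -/

/-- **[AF26] §1.7, the Fourier convention** `f̂(ξ) = ∫_ℝ f(u) e^{−iuξ} du`, here for complex `ξ`
(the windows are compactly supported, so `f̂` is entire — Paley–Wiener, (2.7)).
[cite: AlpogeFurman2026, §1.7 (Notation)] -/
def hat (f : ℝ → ℂ) (ξ : ℂ) : ℂ := ∫ u : ℝ, f u * cexp (-(I * ξ * u))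

/-- **[AF26] §2.2, the sample grid** `α_k := T + 2πk/L`, `k ∈ ℤ` (step `h = 2π/L`, the critical
Gabor density for windows of length `L`). [cite: AlpogeFurman2026, §2.2 (before (2.8))] -/
def grid (T L : ℝ) (k : ℤ) : ℝ := T + 2 * π * k / L

/-- Unfolding `f̂`. [cite: AlpogeFurman2026, §1.7 (Notation)] -/
theorem hat_def (f : ℝ → ℂ) (ξ : ℂ) : hat f ξ = ∫ u : ℝ, f u * cexp (-(I * ξ * u)) := rfl

/-- Unfolding `α_k`. [cite: AlpogeFurman2026, §2.2 (before (2.8))] -/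
theorem grid_def (T L : ℝ) (k : ℤ) : grid T L k = T + 2 * π * k / L := rfl

/-- `f̂(0) = ∫ f`. [cite: AlpogeFurman2026, §1.7 (Notation)] -/
@[simp] theorem hat_zero (f : ℝ → ℂ) : hat f 0 = ∫ u : ℝ, f u := by
  simp [hat]

/-- A window supported in `(−L/2, L/2)` vanishes off that interval. [folklore] -/
private theorem apply_eq_zero {E : Type*} [Zero E] {L : ℝ} {φ : ℝ → E}
    (hsupp : Function.support φ ⊆ Ioo (-(L / 2)) (L / 2)) {u : ℝ}
    (hu : u ∉ Ioo (-(L / 2)) (L / 2)) : φ u = 0 := by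
  by_contra h
  exact hu (hsupp h)

variable {L : ℝ} {φ : ℝ → ℂ}

/-- For a window supported in `(−L/2, L/2)`, `f̂(ξ) = ∫_{−L/2}^{−L/2+L} φ(u) e^{−iξu} du`.
[cite: AlpogeFurman2026, §2.2 ("`supp φ = [−L/2, L/2]`")] -/
theorem hat_eq_intervalIntegral (hL : 0 < L) (hsupp : Function.support φ ⊆ Ioo (-(L / 2)) (L / 2))
    (ξ : ℂ) : hat φ ξ = ∫ u in (-(L / 2))..(-(L / 2) + L), φ u * cexp (-(I * ξ * u)) := by
  rw [intervalIntegral.integral_of_le (by linarith), hat]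
  refine (setIntegral_eq_integral_of_forall_compl_eq_zero fun u hu ↦ ?_).symm
  rw [apply_eq_zero hsupp (fun h ↦ hu ⟨h.1, by linarith [h.2]⟩), zero_mul]

/-- A continuous function is square-integrable on a bounded interval. [folklore] -/
private theorem memLp_two_restrict_Ioc {f : ℝ → ℂ} (hf : Continuous f) (a b : ℝ) :
    MemLp f 2 (volume.restrict (Ioc a b)) := by
  obtain ⟨C, hC⟩ := (isCompact_Icc (a := a) (b := b)).exists_bound_of_continuousOn hf.continuousOn
  exact MemLp.of_bound hf.aestronglyMeasurable C
    (ae_restrict_of_forall_mem measurableSet_Ioc fun x hx ↦ hC x (Ioc_subset_Icc_self hx))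

/-- Three exponentials combine. [folklore] -/
private theorem cexp_three (A B C : ℂ) : cexp A * cexp B * cexp C = cexp (A + B + C) := by
  rw [Complex.exp_add, Complex.exp_add]

/-- **[AF26] Lemma 2.1 without the evenness of the window.** For `L > 0`, `T ∈ ℝ`,
`α_k = T + 2πk/L`, and any continuous `φ : ℝ → ℂ` supported in `(−L/2, L/2)`, for all `z, z′ ∈ ℂ`:
`Σ_{k ∈ ℤ} φ̂(z − α_k) φ̂(z′ − α_k) = L · (φ · φ(−·))^(z − z′)` (unconditionally convergent).
Proof (OURS): polarised Parseval for Mathlib's Fourier basis of `L²(ℝ/Lℤ)` applied to the lifts of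
`conj(φ(u) e^{−izu} e^{iTu})` and `φ(−u) e^{iz′u} e^{−iTu}` from `(−L/2, −L/2 + L]`; the `k`-th
products of coefficients are `L^{−2} φ̂(z − α_k) φ̂(z′ − α_k)` and the inner product is
`L^{−1} ∫ φ(u)φ(−u) e^{−i(z−z′)u} du`. [cite: AlpogeFurman2026, Lemma 2.1 (p. 4)] -/
theorem hasSum_hat_mul_hat (hL : 0 < L) (T : ℝ) (hφ : Continuous φ)
    (hsupp : Function.support φ ⊆ Ioo (-(L / 2)) (L / 2)) (z z' : ℂ) :
    HasSum (fun k : ℤ ↦ hat φ (z - grid T L k) * hat φ (z' - grid T L k))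
      (L * hat (fun u ↦ φ u * φ (-u)) (z - z')) := by
  haveI : Fact (0 < L) := ⟨hL⟩
  have hab : -(L / 2) < -(L / 2) + L := lt_add_of_pos_right _ hL
  have hL0 : (L : ℂ) ≠ 0 := by exact_mod_cast hL.ne'
  -- the two functions on `(−L/2, −L/2 + L]`
  obtain ⟨f₁, hf₁⟩ : ∃ f : ℝ → ℂ,
      f = fun u ↦ conj (φ u * cexp (-(I * z * u)) * cexp (I * T * u)) := ⟨_, rfl⟩
  obtain ⟨g₁, hg₁⟩ : ∃ g : ℝ → ℂ,
      g = fun u ↦ φ (-u) * cexp (I * z' * u) * cexp (-(I * T * u)) := ⟨_, rfl⟩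
  have hf₁c : Continuous f₁ := by
    rw [hf₁]; exact Complex.continuous_conj.comp (by fun_prop)
  have hg₁c : Continuous g₁ := by
    rw [hg₁]; fun_prop
  have hF : MemLp (AddCircle.liftIoc L (-(L / 2)) f₁) 2 (haarAddCircle (T := L)) :=
    (memLp_two_restrict_Ioc hf₁c (-(L / 2)) (-(L / 2) + L)).memLp_liftIoc.haarAddCircle
  have hG : MemLp (AddCircle.liftIoc L (-(L / 2)) g₁) 2 (haarAddCircle (T := L)) :=
    (memLp_two_restrict_Ioc hg₁c (-(L / 2)) (-(L / 2) + L)).memLp_liftIoc.haarAddCircle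
  -- Parseval, polarised
  have hPars := (fourierBasis (T := L)).hasSum_inner_mul_inner (hF.toLp _) (hG.toLp _)
  -- (1) the coefficients of `G`
  have hcoefY : ∀ k : ℤ, ⟪(fourierBasis (T := L)) k, hG.toLp _⟫_ℂ =
      1 / (L : ℂ) * hat φ (z' - grid T L k) := by
    intro k
    obtain ⟨H, hH⟩ : ∃ H : ℝ → ℂ, H = fun u ↦ φ u * cexp (-(I * (z' - grid T L k) * u)) :=
      ⟨_, rfl⟩
    -- pointwise: the integrand is `H (−x)`
    have hpt : ∀ x : ℝ, fourier (-k) (x : AddCircle L) • g₁ x = H (-x) := by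
      intro x
      simp only [hg₁, hH, smul_eq_mul]
      rw [fourier_coe_apply]
      have hexp : cexp (2 * π * I * ((-k : ℤ) : ℂ) * x / L) * cexp (I * z' * x) *
          cexp (-(I * T * x)) = cexp (-(I * (z' - (grid T L k : ℝ)) * ((-x : ℝ) : ℂ))) := by
        rw [cexp_three]
        congr 1
        simp only [grid]
        push_cast
        field_simp
        ring
      calc cexp (2 * π * I * ((-k : ℤ) : ℂ) * x / L) * (φ (-x) * cexp (I * z' * x) *
            cexp (-(I * T * x)))
          = φ (-x) * (cexp (2 * π * I * ((-k : ℤ) : ℂ) * x / L) * cexp (I * z' * x) *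
            cexp (-(I * T * x))) := by ring
        _ = φ (-x) * cexp (-(I * (z' - (grid T L k : ℝ)) * ((-x : ℝ) : ℂ))) := by rw [hexp]
    have hI : ∫ x in (-(L / 2))..(-(L / 2) + L),
        fourier (-k) (x : AddCircle L) • AddCircle.liftIoc L (-(L / 2)) g₁ x =
        ∫ x in (-(L / 2))..(-(L / 2) + L), H (-x) := by
      refine intervalIntegral.integral_congr_ae (ae_of_all _ fun x hx ↦ ?_)
      rw [uIoc_of_le hab.le] at hx
      rw [AddCircle.liftIoc_coe_apply hx]
      exact hpt x
    rw [← (fourierBasis (T := L)).repr_apply_apply (hG.toLp _) k, fourierBasis_repr,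
      fourierCoeff_congr_ae hG.coeFn_toLp, fourierCoeff_eq_intervalIntegral _ k (-(L / 2)),
      Complex.real_smul, hI, intervalIntegral.integral_comp_neg,
      show -(-(L / 2) + L) = -(L / 2) by ring, show -(-(L / 2)) = -(L / 2) + L by ring]
    simp only [hH]
    rw [← hat_eq_intervalIntegral hL hsupp]
    push_cast
    ring
  -- (2) the coefficients of `F`
  have hcoefX : ∀ k : ℤ, ⟪hF.toLp _, (fourierBasis (T := L)) k⟫_ℂ =
      1 / (L : ℂ) * hat φ (z - grid T L k) := by
    intro k
    have hpt : ∀ x : ℝ, fourier k (x : AddCircle L) * conj (f₁ x) =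
        φ x * cexp (-(I * (z - grid T L k) * x)) := by
      intro x
      simp only [hf₁, Complex.conj_conj]
      rw [fourier_coe_apply]
      have hexp : cexp (2 * π * I * (k : ℂ) * x / L) * cexp (-(I * z * x)) * cexp (I * T * x) =
          cexp (-(I * (z - (grid T L k : ℝ)) * x)) := by
        rw [cexp_three]
        congr 1
        simp only [grid]
        push_cast
        field_simp
        ring
      calc cexp (2 * π * I * (k : ℂ) * x / L) * (φ x * cexp (-(I * z * x)) * cexp (I * T * x))
          = φ x * (cexp (2 * π * I * (k : ℂ) * x / L) * cexp (-(I * z * x)) *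
              cexp (I * T * x)) := by ring
        _ = φ x * cexp (-(I * (z - (grid T L k : ℝ)) * x)) := by rw [hexp]
    have hI : ∫ x in Ioc (-(L / 2)) (-(L / 2) + L),
        conj (fourier (-k) (x : AddCircle L) • AddCircle.liftIoc L (-(L / 2)) f₁ x) =
        ∫ x in Ioc (-(L / 2)) (-(L / 2) + L), φ x * cexp (-(I * (z - grid T L k) * x)) := by
      refine setIntegral_congr_fun measurableSet_Ioc fun x hx ↦ ?_
      rw [AddCircle.liftIoc_coe_apply hx, smul_eq_mul, map_mul, fourier_neg, Complex.conj_conj]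
      exact hpt x
    rw [← inner_conj_symm, ← (fourierBasis (T := L)).repr_apply_apply (hF.toLp _) k,
      fourierBasis_repr, fourierCoeff_congr_ae hF.coeFn_toLp,
      fourierCoeff_eq_intervalIntegral _ k (-(L / 2)), Complex.real_smul, map_mul,
      Complex.conj_ofReal, intervalIntegral.integral_of_le hab.le, ← integral_conj, hI,
      ← intervalIntegral.integral_of_le hab.le, ← hat_eq_intervalIntegral hL hsupp]
    push_cast
    ring
  -- (3) the inner product
  have hsupp2 : Function.support (fun u ↦ φ u * φ (-u)) ⊆ Ioo (-(L / 2)) (L / 2) := by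
    intro u hu
    by_contra h
    exact hu (by simp [apply_eq_zero hsupp h])
  have hXY : ⟪hF.toLp _, hG.toLp _⟫_ℂ = (L : ℂ)⁻¹ * hat (fun u ↦ φ u * φ (-u)) (z - z') := by
    rw [MeasureTheory.L2.inner_def]
    have hae : (fun t ↦ ⟪hF.toLp _ t, hG.toLp _ t⟫_ℂ) =ᵐ[haarAddCircle]
        fun t ↦ AddCircle.liftIoc L (-(L / 2)) (fun u ↦ conj (f₁ u) * g₁ u) t := by
      filter_upwards [hF.coeFn_toLp, hG.coeFn_toLp] with t hXt hYt
      rw [RCLike.inner_apply', hXt, hYt]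
      rfl
    rw [integral_congr_ae hae, AddCircle.integral_haarAddCircle,
      AddCircle.integral_liftIoc_eq_intervalIntegral]
    have hpt : ∀ u : ℝ, conj (f₁ u) * g₁ u = φ u * φ (-u) * cexp (-(I * (z - z') * u)) := by
      intro u
      simp only [hf₁, hg₁, Complex.conj_conj]
      have hexp : cexp (-(I * z * u)) * cexp (I * T * u) * cexp (I * z' * u) *
          cexp (-(I * T * u)) = cexp (-(I * (z - z') * (u : ℂ))) := by
        rw [cexp_three, ← Complex.exp_add]
        congr 1
        ring
      calc φ u * cexp (-(I * z * u)) * cexp (I * T * u) *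
            (φ (-u) * cexp (I * z' * u) * cexp (-(I * T * u)))
          = φ u * φ (-u) * (cexp (-(I * z * u)) * cexp (I * T * u) * cexp (I * z' * u) *
              cexp (-(I * T * u))) := by ring
        _ = φ u * φ (-u) * cexp (-(I * (z - z') * (u : ℂ))) := by rw [hexp]
    rw [intervalIntegral.integral_congr (fun u _ ↦ hpt u), ← hat_eq_intervalIntegral hL hsupp2,
      Complex.real_smul]
    push_cast
    ring
  -- assemble: multiply Parseval by `L²`
  have h2 := hPars.mul_left ((L : ℂ) ^ 2)
  have hfun : (fun i : ℤ ↦ (L : ℂ) ^ 2 *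
      (⟪hF.toLp _, (fourierBasis (T := L)) i⟫_ℂ * ⟪(fourierBasis (T := L)) i, hG.toLp _⟫_ℂ)) =
      fun k : ℤ ↦ hat φ (z - grid T L k) * hat φ (z' - grid T L k) := by
    funext k
    rw [hcoefX, hcoefY]
    field_simp
  have hval : (L : ℂ) ^ 2 * ⟪hF.toLp _, hG.toLp _⟫_ℂ = L * hat (fun u ↦ φ u * φ (-u)) (z - z') := by
    rw [hXY]
    field_simp
  rw [hfun, hval] at h2
  exact h2

/-- **[AF26] Lemma 2.1 (Poisson–Gabor identity), AS PRINTED.** For `L > 0`, `T ∈ ℝ`,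
`α_k = T + 2πk/L` and an EVEN continuous window `φ` supported in `(−L/2, L/2)` (the source's
`φ ∈ C_c²(ℝ)` even with `supp φ = [−L/2, L/2]`, (2.6)): for all `z, z′ ∈ ℂ`,
`Σ_{k ∈ ℤ} φ̂(z − α_k) φ̂(z′ − α_k) = L · (φ²)^(z − z′)`.
"Thus the Gabor system at the critical density `h = 2π/L` has a translation-invariant frame kernel
with no aliasing error, for any window supported in an interval of length `L`."
[cite: AlpogeFurman2026, Lemma 2.1 (p. 4)] -/
theorem _root_.Literature.NumberTheory.LFunctions.AlpogeFurman2026_poisson_gabor (hL : 0 < L)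
    (T : ℝ) (hφ : Continuous φ) (hsupp : Function.support φ ⊆ Ioo (-(L / 2)) (L / 2))
    (heven : ∀ u, φ (-u) = φ u) (z z' : ℂ) :
    HasSum (fun k : ℤ ↦ hat φ (z - grid T L k) * hat φ (z' - grid T L k))
      (L * hat (fun u ↦ φ u ^ 2) (z - z')) := by
  have h := hasSum_hat_mul_hat hL T hφ hsupp z z'
  simp_rw [heven, ← pow_two] at h
  exact h

/-- **[AF26] Lemma 2.1, "in particular"**: `Σ_{k ∈ ℤ} φ̂(z − α_k)² = L ∫ φ² (= L‖φ‖₂² = aL²` for a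
real window). [cite: AlpogeFurman2026, Lemma 2.1 (p. 4)] -/
theorem _root_.Literature.NumberTheory.LFunctions.AlpogeFurman2026_poisson_gabor_diag (hL : 0 < L)
    (T : ℝ) (hφ : Continuous φ) (hsupp : Function.support φ ⊆ Ioo (-(L / 2)) (L / 2))
    (heven : ∀ u, φ (-u) = φ u) (z : ℂ) :
    HasSum (fun k : ℤ ↦ hat φ (z - grid T L k) ^ 2) (L * ∫ u : ℝ, φ u ^ 2) := by
  have h := AlpogeFurman2026_poisson_gabor hL T hφ hsupp heven z z
  simp_rw [← pow_two, sub_self, hat_zero] at h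
  exact h

/-! ## Real even windows at real frequencies: `φ̂` is real, and the truncation bound -/

/-- For a real, even window, `φ̂(ξ)` is real for real `ξ` (the sine part of the integrand is odd).
[cite: AlpogeFurman2026, §5.1 ("`φ̂` and `Φ` are real, even, entire")] -/
theorem hat_ofReal_im_eq_zero {ψ : ℝ → ℝ} (heven : ∀ u, ψ (-u) = ψ u) (ξ : ℝ)
    (hint : Integrable fun u : ℝ ↦ (ψ u : ℂ) * cexp (-(I * ξ * u))) :
    (hat (fun u ↦ (ψ u : ℂ)) ξ).im = 0 := by
  rw [hat]
  have him := integral_im hint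
  simp only [RCLike.im_to_complex] at him
  rw [← him]
  have hpt : ∀ u : ℝ, ((ψ u : ℂ) * cexp (-(I * ξ * u))).im = -(ψ u * Real.sin (ξ * u)) := by
    intro u
    rw [Complex.im_ofReal_mul, Complex.exp_im]
    simp [Complex.neg_re, Complex.neg_im, Complex.mul_re, Complex.mul_im, Real.sin_neg]
  simp_rw [hpt]
  rw [integral_neg, neg_eq_zero]
  -- the integrand `ψ(u) sin(ξu)` is odd, so its integral vanishes
  have h1 : ∫ u : ℝ, ψ (-u) * Real.sin (ξ * -u) = ∫ u : ℝ, ψ u * Real.sin (ξ * u) :=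
    integral_neg_eq_self (fun u : ℝ ↦ ψ u * Real.sin (ξ * u)) volume
  have h2 : ∫ u : ℝ, ψ (-u) * Real.sin (ξ * -u) = -∫ u : ℝ, ψ u * Real.sin (ξ * u) := by
    rw [← integral_neg]
    refine integral_congr_ae (Eventually.of_forall fun u ↦ ?_)
    simp only [heven, mul_neg, Real.sin_neg]
  linarith

/-- **[AF26] Lemma 2.1, truncation** ("For `z = z′` real, truncating to `0 ≤ k < d` gives
`‖v_ρ‖₂² ≤ aL²` for `ρ ∈ on`"): for a real, even, continuous window `ψ` supported in `(−L/2, L/2)`,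
a real frequency `γ` and ANY finite set `S` of indices,
`Σ_{k ∈ S} ψ̂(γ − α_k)² ≤ L ∫ ψ² (= L‖ψ‖₂² = aL²)`, the terms `ψ̂(γ − α_k)` being real.
[cite: AlpogeFurman2026, Lemma 2.1 (p. 4)] -/
theorem _root_.Literature.NumberTheory.LFunctions.AlpogeFurman2026_gabor_truncation (hL : 0 < L)
    (T : ℝ) {ψ : ℝ → ℝ} (hψ : Continuous ψ) (hsupp : Function.support ψ ⊆ Ioo (-(L / 2)) (L / 2))
    (heven : ∀ u, ψ (-u) = ψ u) (γ : ℝ) (S : Finset ℤ) :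
    ∑ k ∈ S, (hat (fun u ↦ (ψ u : ℂ)) (γ - grid T L k)).re ^ 2 ≤ L * ∫ u : ℝ, ψ u ^ 2 := by
  -- the complex window `u ↦ ψ u`
  have hφ : Continuous fun u ↦ (ψ u : ℂ) := Complex.continuous_ofReal.comp hψ
  have hsuppφ : Function.support (fun u ↦ (ψ u : ℂ)) ⊆ Ioo (-(L / 2)) (L / 2) := by
    intro u hu
    apply hsupp
    simp only [Function.mem_support, ne_eq, Complex.ofReal_eq_zero] at hu ⊢
    exact hu
  have hevenφ : ∀ u, ((ψ (-u) : ℝ) : ℂ) = (ψ u : ℂ) := fun u ↦ by rw [heven]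
  have h := AlpogeFurman2026_poisson_gabor_diag hL T hφ hsuppφ hevenφ γ
  -- compact support ⇒ integrability, so that `ψ̂` is real at real frequencies
  have hK : HasCompactSupport ψ :=
    HasCompactSupport.intro (isCompact_Icc : IsCompact (Icc (-(L / 2)) (L / 2)))
      fun u hu ↦ apply_eq_zero hsupp fun h' ↦ hu (Ioo_subset_Icc_self h')
  have hreal : ∀ ξ : ℝ, hat (fun u ↦ (ψ u : ℂ)) ξ = ((hat (fun u ↦ (ψ u : ℂ)) ξ).re : ℂ) := by
    intro ξ
    have hKξ : HasCompactSupport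
        ((fun u : ℝ ↦ (ψ u : ℂ)) * fun u : ℝ ↦ cexp (-(I * ξ * u))) :=
      (hK.comp_left (g := Complex.ofReal) Complex.ofReal_zero).mul_right
    have hcont : Continuous ((fun u : ℝ ↦ (ψ u : ℂ)) * fun u : ℝ ↦ cexp (-(I * ξ * u))) :=
      hφ.mul (by fun_prop)
    have hint : Integrable fun u : ℝ ↦ (ψ u : ℂ) * cexp (-(I * ξ * u)) :=
      hcont.integrable_of_hasCompactSupport hKξ
    apply Complex.ext
    · simp
    · rw [Complex.ofReal_im]
      exact hat_ofReal_im_eq_zero heven ξ hint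
  -- each term of the diagonal identity is the square of a real number
  have hterm : ∀ k : ℤ, hat (fun u ↦ (ψ u : ℂ)) ((γ : ℂ) - (grid T L k : ℝ)) ^ 2 =
      (((hat (fun u ↦ (ψ u : ℂ)) ((γ : ℂ) - (grid T L k : ℝ))).re ^ 2 : ℝ) : ℂ) := by
    intro k
    have hk := hreal (γ - grid T L k)
    push_cast at hk
    rw [Complex.ofReal_pow, ← hk]
  simp_rw [hterm] at h
  have hI : (L : ℂ) * ∫ u : ℝ, ((ψ u : ℝ) : ℂ) ^ 2 = ((L * ∫ u : ℝ, ψ u ^ 2 : ℝ) : ℂ) := by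
    rw [Complex.ofReal_mul, ← integral_complex_ofReal]
    simp_rw [Complex.ofReal_pow]
  rw [hI] at h
  have hre := Complex.hasSum_re h
  simp only [Complex.ofReal_re] at hre
  exact sum_le_hasSum S (fun k _ ↦ sq_nonneg _) hre

end AlpogeFurman2026

end Literature.NumberTheory.LFunctions

end
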